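import Summits.MatrixMultiplication.MatrixMultiplication.Theses.WindowedCompletionRank

/-!
# MatrixMultiplication / WindowedCompletionRank — `Assembly` (stmt-MatrixMultiplication-5503)

Route `WindowedCompletionRank`, assembly item (rank 1):

  `HadamardRankLe → AddTableRankLe → Thesis → MatrixMultiplication`.

This is, verbatim, the type of the route's kernel-checked deciding theorem
`Summit.MatrixMultiplication.MatrixMultiplication.Theses.WindowedCompletionRank.closes`; the proof
below replays that `ε`-bookkeeping against the literal route decl without depending on `closes`
itself (so the file survives any later re-authoring of the deciding theorem's proof script).

Argument. `2 ≤ ω(ℂ)` is the flattening bound `omega_two_le`. For the other inequality fix `δ > 0`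
and feed `ε := δ/2` to `Thesis`: it returns `n ≥ 2`, a finite abelian group `G` with
`|G| ≤ n^(2+δ/2)`, index maps `α β γ : [n]² → G` and a completion `S : G³ → ℂ` with `R(S) ≤ n^(δ/2)`
such that `⟨n,n,n⟩` is a restriction of the windowed Hadamard product
`W a b c = [α b + β c = γ a] · S (γ a) (α b) (β c)`. Then
* `R(⟨n,n,n⟩) ≤ R(W)` (`TensorRestrictsTo.tensorRank_le`, Bläser 2013 Lemma 5.4);
* `W = T ∘ (γ, α, β)` with `T g u v = [u + v = g] · S g u v`, so `R(W) ≤ R(T)`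
  (`tensorRestrictsTo_precomp`);
* `T` is the entrywise product of the addition table `U_G g u v = [u + v = g]` with `S`, so
  `R(T) ≤ R(U_G) · R(S) ≤ |G| · R(S)` (the two support hypotheses `HadamardRankLe`, `AddTableRankLe`);
* hence `ω(ℂ) ≤ log_n (|G| · R(S)) ≤ log_n (n^(2+δ/2) · n^(δ/2)) = 2 + δ`
  (`advxxz2025_omega_le_logb_of_tensorRank_le`, every rank bound on `⟨n,n,n⟩`, `n ≥ 2`, bounds `ω`).
Letting `δ → 0` (`le_of_forall_pos_le_add`) gives `ω(ℂ) ≤ 2`, and `MatrixMultiplication ↔ ω(ℂ) = 2`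
(`MatrixMultiplication_iff`). No named unproved fact is used.
-/

-- the tree's namespace `Summit.MatrixMultiplication.MatrixMultiplication.…` repeats a component by design
set_option linter.dupNamespace false

namespace Summit.MatrixMultiplication.MatrixMultiplication.Theorems

open Summit.MatrixMultiplication.MatrixMultiplication.Theses.WindowedCompletionRank
open Literature.Computability.AlgebraicComplexity

/-- The rank chain of the route: if `⟨n,n,n⟩` is a restriction of the windowed Hadamard product
`[α b + β c = γ a] · S (γ a) (α b) (β c)` over a finite abelian group `G`, and Hadamard products are
rank-submultiplicative and the addition table of `G` has rank `≤ |G|`, then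
`R(⟨n,n,n⟩) ≤ |G| · R(S)`. [folklore] -/
theorem windowedCompletionRank_tensorRank_matMul_le_card_mul (hH : HadamardRankLe)
    (hA : AddTableRankLe) {n : ℕ} {G : Type} [AddCommGroup G] [Fintype G] [DecidableEq G]
    (α β γ : Fin n × Fin n → G) (S : G → G → G → ℂ)
    (hres : TensorRestrictsTo
      (fun a b c : Fin n × Fin n => if α b + β c = γ a then S (γ a) (α b) (β c) else 0)
      (matMulTensor ℂ n n n)) :
    tensorRank (matMulTensor ℂ n n n) ≤ Fintype.card G * tensorRank S := by
  -- R(⟨n,n,n⟩) ≤ R(window)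
  have h1 : tensorRank (matMulTensor ℂ n n n) ≤
      tensorRank (fun a b c : Fin n × Fin n => if α b + β c = γ a then S (γ a) (α b) (β c) else 0) :=
    hres.tensorRank_le
  -- window = T ∘ (γ, α, β) with T g u v = [u + v = g] · S g u v
  have h2 : TensorRestrictsTo (fun g u v : G => if u + v = g then S g u v else 0)
      (fun a b c : Fin n × Fin n => if α b + β c = γ a then S (γ a) (α b) (β c) else 0) :=
    tensorRestrictsTo_precomp (fun g u v : G => if u + v = g then S g u v else 0) γ α β
  -- T = U_G ∘ S entrywise
  have hEq : (fun g u v : G => if u + v = g then S g u v else 0) =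
      fun g u v : G => (if u + v = g then (1 : ℂ) else 0) * S g u v := by
    funext g u v
    split_ifs <;> simp
  have h3 : tensorRank (fun g u v : G => if u + v = g then S g u v else 0) ≤
      tensorRank (fun g u v : G => if u + v = g then (1 : ℂ) else 0) * tensorRank S := by
    rw [hEq]
    exact hH G G G (fun g u v : G => if u + v = g then (1 : ℂ) else 0) S
  -- R(U_G) ≤ |G|
  have h4 : tensorRank (fun g u v : G => if u + v = g then (1 : ℂ) else 0) ≤ Fintype.card G := hA G
  exact h1.trans (h2.tensorRank_le.trans (h3.trans (Nat.mul_le_mul_right _ h4)))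

/-- **Assembly of route `WindowedCompletionRank`** (settles `stmt-MatrixMultiplication-5503`, exact
route signature `Summit.MatrixMultiplication.MatrixMultiplication.Theses.WindowedCompletionRank.Assembly`):
`HadamardRankLe → AddTableRankLe → Thesis → MatrixMultiplication`. For `δ > 0` the thesis at
`ε = δ/2` gives `R(⟨n,n,n⟩) ≤ |G| · R(S) ≤ n^(2+δ/2) · n^(δ/2) = n^(2+δ)` with `n ≥ 2`, hence
`ω(ℂ) ≤ 2 + δ` (`advxxz2025_omega_le_logb_of_tensorRank_le`); so `ω(ℂ) ≤ 2`, and `2 ≤ ω(ℂ)` is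
`omega_two_le`. [folklore] -/
theorem windowedCompletionRank_assembly_proof :
    Summit.MatrixMultiplication.MatrixMultiplication.Theses.WindowedCompletionRank.Assembly := by
  unfold Assembly
  intro hH hA hT
  rw [MatrixMultiplication_iff]
  refine le_antisymm ?_ (omega_two_le ℂ)
  refine le_of_forall_pos_le_add fun δ hδ => ?_
  obtain ⟨n, hn, G, instG, instF, instD, hcard, α, β, γ, S, hS, hres⟩ := hT (δ / 2) (half_pos hδ)
  have hr : tensorRank (matMulTensor ℂ n n n) ≤ Fintype.card G * tensorRank S :=
    windowedCompletionRank_tensorRank_matMul_le_card_mul hH hA α β γ S hres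
  refine (advxxz2025_omega_le_logb_of_tensorRank_le ℂ hn hr).trans ?_
  have hn1 : (1 : ℝ) < n := by exact_mod_cast lt_of_lt_of_le (by norm_num) hn
  have hn0 : (0 : ℝ) < n := by linarith
  rcases Nat.eq_zero_or_pos (Fintype.card G * tensorRank S) with h0 | hpos
  · rw [h0, Nat.cast_zero, Real.logb_zero]
    linarith
  · rw [Real.logb_le_iff_le_rpow hn1 (by exact_mod_cast hpos), Nat.cast_mul]
    calc (Fintype.card G : ℝ) * (tensorRank S : ℝ)
        ≤ (n : ℝ) ^ (2 + δ / 2) * (n : ℝ) ^ (δ / 2) :=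
          mul_le_mul hcard hS (Nat.cast_nonneg _) (Real.rpow_nonneg hn0.le _)
      _ = (n : ℝ) ^ (2 + δ) := by
          rw [← Real.rpow_add hn0]
          congr 1
          ring

end Summit.MatrixMultiplication.MatrixMultiplication.Theorems
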